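import Summits.FinalStateConjecture.FinalStateConjecture.Theses.PhotonSphereChannels
import Summits.FinalStateConjecture.FinalStateConjecture.Theorems.PhotonSphereChannelsFrozenPacketMain
import Summits.FinalStateConjecture.FinalStateConjecture.Theorems.PhotonSphereChannelsUniformPhotonSphereChannelsNearKernelCensus

/-!
# Route PhotonSphereChannels — REFUTATION of the crux `UniformPhotonSphereChannels` (K1, item
# stmt-FinalStateConjecture-10045): no `ℓ`-uniform exterior-cone channel constant exists for any
# fixed excised ball

`not_UniformPhotonSphereChannels : ¬ UniformPhotonSphereChannels`, sorry-free.

**Witness family (frozen velocity packets).** Given the `ρ₀(M)`, `c(M)` that K1 claims at `M = 1`,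
take the tortoise radius `r = tortoiseRadius` centred at `xc = 0`, the ball `ρ = ρ₀`, spin `s = 2`,
`ℓ = m⁴`, and ODD Cauchy data `(0, g)` with `g(x) = B(m³(x − α))` a `C²` plateau bump of width
`3/m³` sitting flush below the near edge `xe = −ρ₀` (`α = xe − 3/m³`).  Two facts:

1. *Escape in time `T = 3/m³`* (`FrozenPacket.frozen_packet_main`, this seat): over the time the
   light-speed near edge `xe − |t|` needs to sweep past the packet, the true solution stays within
   `O(m^{-1}) √E₀` (energy norm) of the motionless ansatz `g(x) sin(ωt)/ω`, `ω² = V_ℓ(α) ≍ m⁸`, so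
   the exterior energy at the times `±T` is `≤ (c/4) ∫ g²`; by the landed monotonicity of exterior
   energies (`RW.exteriorEnergy_antitoneOn_rw`) both channel energies are then `≤ (c/4) ∫ g²`.
2. *Coercive side* (`deficit_lower_bound`, from the landed near-side kernel census
   `KruskalRestFrameVirial.stub_nearKernelCensus`): a `t`-polynomial kernel element with finite
   near energy is static on the near cone, so its velocity trace vanishes below `xe` and
   `dist²((0, g), P(ρ)) ≥ ∫ g²`.

Hence `c ∫ g² ≤ (c/2) ∫ g²` with `∫ g² > 0`: contradiction.  No long-time dynamics (no lag law,
no Kruskal frame, no Gaussian beams) is used — only that a deep sub-barrier rest packet does not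
instantly follow a receding light-speed edge.  The refutation is *substantive*: the witnesses work
at EVERY `ρ₀ ≥ 0` and the lost data are an infinite-dimensional family as `ℓ → ∞`; the route's
declared repairs (an `ℓ`-dependent ball `ρ₀(ℓ)`, or horizon-flux near ends) are not hit.

Glue lemmas `channelInequality_of_uniform`, `deficit_lower_bound`, `channelEnergy_le_of_antitone`
are the proved glue of the line skeleton `Cruxes/UniformPhotonSphereChannels/Lines/
kruskal-rest-frame-virial.lean` (crux planner / line lead), re-proved here for `s = 2`.

**Record (2026-08-16, housekeeping).** The route's rev-7 repair dropped the refuted constant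
`…Theses.PhotonSphereChannels.UniformPhotonSphereChannels` from the Theses file; it is re-declared
below, verbatim, in the route namespace, so that this append-only refutation keeps elaborating (all
theorems unchanged).
-/

noncomputable section

namespace Summit.FinalStateConjecture.FinalStateConjecture.Theses.PhotonSphereChannels

open scoped BigOperators Topology Manifold Classical MeasureTheory ProbabilityTheory Matrix InnerProductSpace ComplexConjugate ContinuousMap
open Filter Set Function TopologicalSpace MeasureTheory

/-- **Record of the dropped route item `UniformPhotonSphereChannels`** = stmt-FinalStateConjecture-10045
(K1; ledger signature verbatim, in the route file's namespace and `open` context; NOT a route item —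
no `route_item` attribute): after `Theorems.not_UniformPhotonSphereChannels` (below) closed the item
`refuted` (2026-08-16T02:11:05Z), the rev-7 route repair dropped this constant from the gate-written
Theses file, while this Theorems file — append-only, statement text `¬ UniformPhotonSphereChannels`
fixed — still names it, so this module (and its importer
`Theorems/WindowedShellChannels/Negative/FalseWithoutLag.lean`) stopped elaborating ("Unknown
identifier", builds of 2026-08-16; housekeeping request attached to stmt-FinalStateConjecture-14078).
Re-declared here under its ORIGINAL fully-qualified name with its ORIGINAL definiens solely so that
the refutation record keeps elaborating (pattern of the record in
`Theorems/PhotonSphereChannelsBlindnessInsidePhotonSphere.lean`).  It is FALSE — see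
`not_UniformPhotonSphereChannels`.  Informally: for every Schwarzschild mass `M > 0` there are a ball
radius `ρ₀(M)` and a constant `c(M) > 0`, UNIFORM in the spin `s ≤ 2`, the angular number `ℓ ≥ s`
and the ball `ρ ≥ ρ₀`, such that for every tortoise radius function centred at the photon sphere
and every global `C²` Regge–Wheeler solution `ψ`, `c · dist²(ψ(0), P(ρ)) ≤ liminf_{t→+∞} E[ψ;
{|x − x_c| > ρ + |t|}] + liminf_{t→−∞} E[ψ; {|x − x_c| > ρ + |t|}]`, `P(ρ)` the `t`-polynomial
solutions on the exterior cone (the FIXED-ball two-ended channel-of-energy inequality). -/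
def UniformPhotonSphereChannels : Prop :=
  ∀ M : ℝ, 0 < M → ∃ ρ₀ : ℝ, 0 ≤ ρ₀ ∧ ∃ c : ℝ, 0 < c ∧ ∀ (r : ℝ → ℝ) (xc : ℝ), (∀ x, 2 * M < r x) → (∀ x, HasDerivAt r (1 - 2 * M / r x) x) → r xc = 3 * M → ∀ (s ℓ : ℕ), s ≤ 2 → s ≤ ℓ → ∀ ρ : ℝ, ρ₀ ≤ ρ → ∀ ψ : ℝ → ℝ → ℝ, ContDiff ℝ 2 (Function.uncurry ψ) → let V : ℝ → ℝ := fun x => (1 - 2 * M / r x) * ((ℓ : ℝ) * ((ℓ : ℝ) + 1) / r x ^ 2 + (1 - (s : ℝ) ^ 2) * (2 * M) / r x ^ 3); let e : (ℝ → ℝ → ℝ) → ℝ → ℝ → ℝ := fun φ t x => deriv (fun τ => φ τ x) t ^ 2 + deriv (φ t) x ^ 2 + V x * φ t x ^ 2; let IsSol : (ℝ → ℝ → ℝ) → ℝ × ℝ → Prop := fun φ z => iteratedDeriv 2 (fun τ => φ τ z.2) z.1 - iteratedDeriv 2 (φ z.1) z.2 + V z.2 * φ z.1 z.2 = 0; let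 Ω : Set (ℝ × ℝ) := {z | ρ + |z.1| < |z.2 - xc|}; let P : Set (ℝ → ℝ → ℝ) := {p | ContDiffOn ℝ 2 (Function.uncurry p) Ω ∧ (∀ z ∈ Ω, IsSol p z) ∧ ∃ (N : ℕ) (a : ℕ → ℝ → ℝ), ∀ z ∈ Ω, p z.1 z.2 = ∑ i ∈ Finset.range N, a i z.2 * z.1 ^ i}; let Eext : ℝ → ENNReal := fun t => MeasureTheory.lintegral (MeasureTheory.volume.restrict {x : ℝ | ρ + |t| < |x - xc|}) (fun x => ENNReal.ofReal (e ψ t x)); (∀ z, IsSol ψ z) → ENNReal.ofReal c * (⨅ p ∈ P, MeasureTheory.lintegral (MeasureTheory.volume.restrict {x : ℝ | ρ < |x - xc|}) (fun x => ENNReal.ofReal (e (fun t y => ψ t y - p t y) 0 x))) ≤ Filter.liminf Eext Filter.atTop + Filter.liminf Eext Filter.atBot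

end Summit.FinalStateConjecture.FinalStateConjecture.Theses.PhotonSphereChannels

namespace Summit.FinalStateConjecture.FinalStateConjecture.Theorems

open Literature.Geometry.Lorentzian Literature.Geometry.Lorentzian.ReggeWheeler
open Summit.FinalStateConjecture.FinalStateConjecture.Theses.PhotonSphereChannels
open MeasureTheory Filter Set Function
open scoped ENNReal Topology

namespace FrozenPacket

/-! ### Glue over the Regge–Wheeler vocabulary -/

/-- K1 read over `Literature.Geometry.Lorentzian.ReggeWheeler`: tortoise hypotheses =
`IsTortoiseRadius`, conclusion = `ChannelInequality (linePotential M s ℓ r) xc ρ c` (the inlined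
`let`s of the route decl are these definitions verbatim). (Skeleton glue, line
`kruskal-rest-frame-virial`.) -/
theorem channelInequality_of_uniform (h : UniformPhotonSphereChannels) {M : ℝ} (hM : 0 < M) :
    ∃ ρ₀ : ℝ, 0 ≤ ρ₀ ∧ ∃ c : ℝ, 0 < c ∧ ∀ (r : ℝ → ℝ) (xc : ℝ), IsTortoiseRadius M r xc →
      ∀ s ℓ : ℕ, s ≤ 2 → s ≤ ℓ → ∀ ρ : ℝ, ρ₀ ≤ ρ →
        ChannelInequality (linePotential M s ℓ r) xc ρ c := by
  obtain ⟨ρ₀, hρ₀, c, hc, H⟩ := h M hM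
  refine ⟨ρ₀, hρ₀, c, hc, fun r xc hr s ℓ hs hsℓ ρ hρ φ hφ => ?_⟩
  exact H r xc hr.two_mul_lt hr.hasDerivAt hr.center s ℓ hs hsℓ ρ hρ φ hφ.1 hφ.2

/-- **Coercive side for odd data** (`s = 2`): for data `(0, g)` with `g` vanishing on
`[xc − ρ, ∞)`, `∫ g² ≤ dist²(data, P(ρ))` — for a kernel element `p`, either the near energy of
`ψ − p` at `t = 0` is infinite, or `p` itself has finite near energy, hence zero velocity trace
on the near half-line (census), and then `e[ψ − p](0, x) ≥ g(x)²` there. (Skeleton glue, line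
`kruskal-rest-frame-virial`, with `s = 2`.) -/
theorem deficit_lower_bound {M : ℝ} {r : ℝ → ℝ} {xc : ℝ} (hr : IsTortoiseRadius M r xc) (ℓ : ℕ)
    (hℓ : 2 ≤ ℓ) (ρ : ℝ) (ψ : ℝ → ℝ → ℝ) (hψ : ContDiff ℝ 2 (Function.uncurry ψ))
    (hψ0 : ∀ x, ψ 0 x = 0)
    (g : ℝ → ℝ) (hg : Continuous g) (hψt : ∀ x, deriv (fun τ => ψ τ x) 0 = g x)
    (hg0 : ∀ x, xc - ρ ≤ x → g x = 0) (hgi : Integrable (fun x => g x ^ 2))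
    (hcensus : ∀ p ∈ rwKernel (linePotential M 2 ℓ r) xc ρ,
      ∫⁻ x in Iio (xc - ρ), ENNReal.ofReal (energyDensity (linePotential M 2 ℓ r) p 0 x) < ∞ →
        ∀ x, x < xc - ρ → deriv (fun τ => p τ x) 0 = 0) :
    ENNReal.ofReal (∫ x, g x ^ 2) ≤ kernelDeficit (linePotential M 2 ℓ r) xc ρ ψ := by
  set V := linePotential M 2 ℓ r with hV
  have hV0 : ∀ x, 0 ≤ V x := fun x => linePotential_nonneg hr.mass_pos.le hℓ hr.two_mul_lt x
  -- the data integral as a lower integral over the near half-line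
  have hG : ENNReal.ofReal (∫ x, g x ^ 2) = ∫⁻ x in Iio (xc - ρ), ENNReal.ofReal (g x ^ 2) := by
    rw [ofReal_integral_eq_lintegral_ofReal hgi (ae_of_all _ fun x => sq_nonneg (g x)),
      ← lintegral_add_compl (fun x => ENNReal.ofReal (g x ^ 2)) (measurableSet_Iio (a := xc - ρ)),
      setLIntegral_eq_zero (measurableSet_Iio (a := xc - ρ)).compl, add_zero]
    intro x hx
    simp only [mem_compl_iff, mem_Iio, not_lt] at hx
    simp [hg0 x hx]
  have hGfin : ∫⁻ x in Iio (xc - ρ), ENNReal.ofReal (g x ^ 2) < ∞ := hG ▸ ENNReal.ofReal_lt_top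
  have hgm : Measurable fun x => ENNReal.ofReal (g x ^ 2) :=
    ENNReal.measurable_ofReal.comp (hg.pow 2).measurable
  -- slices of ψ are differentiable
  have hslice : ∀ x : ℝ, DifferentiableAt ℝ (fun τ : ℝ => (τ, x)) 0 := fun x => by fun_prop
  have hdψ : ∀ x, DifferentiableAt ℝ (fun τ => ψ τ x) 0 := fun x => by
    have h1 : DifferentiableAt ℝ (Function.uncurry ψ) ((fun τ : ℝ => (τ, x)) 0) :=
      (hψ.differentiable (by norm_num)) _
    exact h1.comp (0 : ℝ) (hslice x)
  unfold kernelDeficit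
  refine le_iInf₂ fun p hp => ?_
  obtain ⟨hpC, hpS, hpP⟩ := hp
  -- slices of p are differentiable at t = 0 on the near half-line
  have hmem : ∀ x, x < xc - ρ → ((0 : ℝ), x) ∈ exteriorCone xc ρ := by
    intro x hx
    simp only [mem_exteriorCone, abs_zero, add_zero]
    rw [abs_sub_comm]
    exact lt_of_lt_of_le (by linarith) (le_abs_self _)
  have hdp : ∀ x, x < xc - ρ → DifferentiableAt ℝ (fun τ => p τ x) 0 := fun x hx => by
    have h1 : DifferentiableAt ℝ (Function.uncurry p) ((fun τ : ℝ => (τ, x)) 0) :=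
      (hpC.contDiffAt ((isOpen_exteriorCone xc ρ).mem_nhds (hmem x hx))).differentiableAt
        (by norm_num)
    exact h1.comp (0 : ℝ) (hslice x)
  set q : ℝ → ℝ := fun x => deriv (fun τ => p τ x) 0 with hq
  have hderiv : ∀ x, x < xc - ρ → deriv (fun τ => ψ τ x - p τ x) 0 = g x - q x := by
    intro x hx
    rw [← hψt x]
    exact deriv_sub (hdψ x) (hdp x hx)
  -- pointwise: the energy density of ψ − p at t = 0 on the near half-line
  have hpt : ∀ x, x < xc - ρ →
      energyDensity V (fun t y => ψ t y - p t y) 0 x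
        = (g x - q x) ^ 2 + deriv (p 0) x ^ 2 + V x * p 0 x ^ 2 := by
    intro x hx
    unfold energyDensity
    rw [hderiv x hx]
    have h2 : (fun t y => ψ t y - p t y) 0 = fun y => -p 0 y := by
      funext y
      simp [hψ0 y]
    rw [h2, deriv.fun_neg]
    ring
  set E := ∫⁻ x in Iio (xc - ρ), ENNReal.ofReal (energyDensity V (fun t y => ψ t y - p t y) 0 x)
    with hE
  have hsub : Iio (xc - ρ) ⊆ {x : ℝ | ρ < |x - xc|} := by
    intro x hx
    simp only [mem_Iio] at hx
    simp only [mem_setOf_eq]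
    rw [abs_sub_comm]
    exact lt_of_lt_of_le (by linarith) (le_abs_self _)
  refine le_trans ?_ (lintegral_mono_set hsub)
  rw [hG]
  change ∫⁻ x in Iio (xc - ρ), ENNReal.ofReal (g x ^ 2) ≤ E
  by_cases hEtop : E = ∞
  · rw [hEtop]; exact le_top
  · -- finite near energy of ψ − p ⇒ finite near energy of p itself (ψ(0,·) = 0, g ∈ L²)
    have hElt : E < ∞ := lt_top_iff_ne_top.2 hEtop
    have hptP : ∀ x ∈ Iio (xc - ρ), ENNReal.ofReal (energyDensity V p 0 x) ≤
        2 * ENNReal.ofReal (energyDensity V (fun t y => ψ t y - p t y) 0 x)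
          + 2 * ENNReal.ofReal (g x ^ 2) := by
      intro x hx
      have h2 : (2 : ℝ≥0∞) = ENNReal.ofReal 2 := by simp
      have hVp : 0 ≤ V x * p 0 x ^ 2 := mul_nonneg (hV0 x) (sq_nonneg _)
      have hA : 0 ≤ 2 * ((g x - q x) ^ 2 + deriv (p 0) x ^ 2 + V x * p 0 x ^ 2) := by positivity
      have hB : 0 ≤ 2 * g x ^ 2 := by positivity
      rw [hpt x hx, h2, ← ENNReal.ofReal_mul zero_le_two, ← ENNReal.ofReal_mul zero_le_two,
        ← ENNReal.ofReal_add hA hB]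
      refine ENNReal.ofReal_le_ofReal ?_
      unfold energyDensity
      nlinarith [sq_nonneg (g x - q x + g x), sq_nonneg (2 * g x - q x), sq_nonneg (deriv (p 0) x),
        sq_nonneg (q x - 2 * g x), hVp]
    have hfinP : ∫⁻ x in Iio (xc - ρ), ENNReal.ofReal (energyDensity V p 0 x) < ∞ := by
      calc ∫⁻ x in Iio (xc - ρ), ENNReal.ofReal (energyDensity V p 0 x)
          ≤ ∫⁻ x in Iio (xc - ρ), (2 * ENNReal.ofReal (energyDensity V (fun t y => ψ t y - p t y) 0 x)
              + 2 * ENNReal.ofReal (g x ^ 2)) := setLIntegral_mono' measurableSet_Iio hptP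
        _ = 2 * E + 2 * ∫⁻ x in Iio (xc - ρ), ENNReal.ofReal (g x ^ 2) := by
            rw [lintegral_add_right _ (hgm.const_mul 2), lintegral_const_mul' _ _ ENNReal.ofNat_ne_top,
              lintegral_const_mul' _ _ ENNReal.ofNat_ne_top]
        _ < ∞ := ENNReal.add_lt_top.2 ⟨ENNReal.mul_lt_top (by simp) hElt,
            ENNReal.mul_lt_top (by simp) hGfin⟩
    -- census: the velocity trace of p vanishes on the near half-line
    have hq0 : ∀ x, x < xc - ρ → q x = 0 := hcensus p ⟨hpC, hpS, hpP⟩ hfinP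
    refine setLIntegral_mono' measurableSet_Iio fun x hx => ?_
    simp only [mem_Iio] at hx
    rw [hpt x hx, hq0 x hx, sub_zero]
    refine ENNReal.ofReal_le_ofReal ?_
    nlinarith [sq_nonneg (deriv (p 0) x), mul_nonneg (hV0 x) (sq_nonneg (p 0 x))]

/-- Channel energies are dominated by the exterior energy at any time beyond which the exterior
energy is monotone. (Skeleton glue, line `kruskal-rest-frame-virial`.) -/
theorem channelEnergy_le_of_antitone {V : ℝ → ℝ} {xc ρ : ℝ} {ψ : ℝ → ℝ → ℝ}
    (h : AntitoneOn (exteriorEnergy V xc ρ ψ) (Ici 0) ∧ MonotoneOn (exteriorEnergy V xc ρ ψ) (Iic 0))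
    {t₁ : ℝ} (ht₁ : 0 ≤ t₁) :
    channelEnergy V xc ρ ψ atTop ≤ exteriorEnergy V xc ρ ψ t₁ ∧
      channelEnergy V xc ρ ψ atBot ≤ exteriorEnergy V xc ρ ψ (-t₁) := by
  constructor
  · refine liminf_le_of_frequently_le' (Eventually.frequently ?_)
    filter_upwards [eventually_ge_atTop t₁] with t ht
    exact h.1 (mem_Ici.2 ht₁) (mem_Ici.2 (ht₁.trans ht)) ht
  · refine liminf_le_of_frequently_le' (Eventually.frequently ?_)
    filter_upwards [eventually_le_atBot (-t₁)] with t ht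
    exact h.2 (mem_Iic.2 (ht.trans (by linarith))) (mem_Iic.2 (by linarith)) ht

/-- **From the near-side integral to the two-ended exterior energy.** For `ρ ≥ 0` and a `C²`
field vanishing outside the domain of influence of `[α, xc − ρ]`, at a time `t` with
`xc − ρ − |t| ≤ α` the exterior energy `∫_{ρ+|t|<|x−xc|} e(t, x) dx` is the energy on a part of
`(−∞, α)` (the far half-line `x > xc + ρ + |t|` carries nothing), hence it is bounded by any
bound `b` on `∫_{(−∞, α)} e(t, x) dx`. -/
theorem exteriorEnergy_le_of_near {V : ℝ → ℝ} {ψ : ℝ → ℝ → ℝ} {xc ρ α t b : ℝ} (hρ : 0 ≤ ρ)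
    (hedge : xc - ρ - |t| ≤ α) (hψ2 : ContDiff ℝ 2 (uncurry ψ))
    (hsupp : ∀ s x, (x < α - |s| ∨ (xc - ρ) + |s| < x) → ψ s x = 0)
    (he0 : ∀ x, 0 ≤ deriv (fun τ => ψ τ x) t ^ 2 + deriv (ψ t) x ^ 2 + V x * ψ t x ^ 2)
    (hInt : Integrable fun x => deriv (fun τ => ψ τ x) t ^ 2 + deriv (ψ t) x ^ 2 + V x * ψ t x ^ 2)
    (hb : ∫ x in Iio α, (deriv (fun τ => ψ τ x) t ^ 2 + deriv (ψ t) x ^ 2 + V x * ψ t x ^ 2) ≤ b) :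
    exteriorEnergy V xc ρ ψ t ≤ ENNReal.ofReal b := by
  unfold exteriorEnergy
  have hd : 0 ≤ ρ + |t| := add_nonneg hρ (abs_nonneg t)
  rw [WaveEnergy.lintegral_setOf_lt_abs_sub xc hd]
  -- the far half-line carries no energy
  have hfar : ∫⁻ x in Ioi (xc + (ρ + |t|)), ENNReal.ofReal (energyDensity V ψ t x) = 0 := by
    refine setLIntegral_eq_zero measurableSet_Ioi fun x hx => ?_
    simp only [mem_Ioi] at hx
    have hx' : x < α - |t| ∨ (xc - ρ) + |t| < x := Or.inr (by linarith)
    show ENNReal.ofReal (energyDensity V ψ t x) = 0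
    unfold energyDensity
    rw [energyDensity_eq_zero_of_exterior hψ2 hsupp hx', ENNReal.ofReal_zero]
  rw [hfar, add_zero]
  -- the near half-line lies below `α`
  have hsub : Iio (xc - (ρ + |t|)) ⊆ Iio α := fun x hx => by
    simp only [mem_Iio] at hx ⊢
    linarith
  refine (lintegral_mono_set hsub).trans ?_
  unfold energyDensity
  rw [← ofReal_integral_eq_lintegral_ofReal hInt.integrableOn (Eventually.of_forall he0)]
  exact ENNReal.ofReal_le_ofReal hb

end FrozenPacket

open FrozenPacket Summit.FinalStateConjecture.FinalStateConjecture.Theorems.Blindness in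
/-- **Refutation of the crux `UniformPhotonSphereChannels`** (K1, item stmt-FinalStateConjecture-10045,
route `PhotonSphereChannels`).  refuted-substantive: at `M = 1`, `xc = 0`, `r = tortoiseRadius`,
`s = 2`, for EVERY `ρ₀ ≥ 0` and `c > 0` the frozen velocity packets `(0, g_m)` of width `3/m³`
flush below the near edge `−ρ₀`, `ℓ = m⁴`, have two-ended channel energy `≤ (c/2) ∫ g_m²` but
kernel deficit `≥ ∫ g_m² > 0` for `m` large — see the module docstring.  No cheap repair at a
fixed ball: the lost data form an infinite-dimensional family as `ℓ → ∞` while the near-side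
finite-energy kernel is static; the route's declared repairs (`ρ₀ = ρ₀(ℓ)`, horizon-flux near ends)
are different statements, not hit by this witness. -/
theorem not_UniformPhotonSphereChannels : ¬ UniformPhotonSphereChannels := by
  intro hK
  obtain ⟨ρ₀, hρ₀, c, hc, H⟩ := channelInequality_of_uniform hK one_pos
  set r : ℝ → ℝ := tortoiseRadius one_pos 0 with hr_def
  have hr : IsTortoiseRadius 1 r 0 := isTortoiseRadius_tortoiseRadius one_pos 0
  -- near edge `xe = 0 − ρ₀` (ball `ρ = ρ₀` about `xc = 0`)
  set xe : ℝ := 0 - ρ₀ with hxe_def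
  -- the bump, the constants of the potential on `[xe − 3, xe]`, and the scale `m`
  obtain ⟨B, hB, h0l, h0r, h1, h01, K₂, hK₂, hB2⟩ := exists_profile
  obtain ⟨f₀, C₀, C₁, hf₀, hC₀, hC₁, hKV⟩ :=
    potential_compact_bounds one_pos hr.two_mul_lt hr.hasDerivAt (a := xe - 3) (b := xe) (by linarith)
  have hε : 0 < c / 4 := by positivity
  obtain ⟨m, hm⟩ := exists_nat_gt (max 2
    (max (2 * C₀ / f₀) (Real.sqrt (108 * (9 * C₁ + K₂) ^ 2 / (c / 4 * f₀)))))
  have hm2r : (2 : ℝ) < m := lt_of_le_of_lt (le_max_left _ _) hm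
  have hm2 : 2 ≤ m := by
    have : (2 : ℕ) < m := by exact_mod_cast hm2r
    omega
  have hm0 : (0 : ℝ) < m := by linarith
  have hmC : 2 * C₀ / f₀ ≤ m := (lt_of_le_of_lt ((le_max_left _ _).trans (le_max_right _ _)) hm).le
  have hmε : 108 * (9 * C₁ + K₂) ^ 2 / (c / 4 * f₀) ≤ (m : ℝ) ^ 2 := by
    have h := lt_of_le_of_lt ((le_max_right _ _).trans (le_max_right _ _)) hm
    exact ((Real.sqrt_lt' hm0).1 h).le
  have hℓ2 : 2 ≤ m ^ 4 := le_trans hm2 (Nat.le_self_pow (by norm_num) m)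
  -- the frozen velocity packet
  obtain ⟨g, α, T, hg2, -, hT0, hedge, -, -, hg0r, hgint, hgpos, ψ, hψ2, hsol, hψ0, hψ1,
      hsupp, he0, hInt, hplus, hminus⟩ :=
    frozen_packet_main one_pos hr.two_mul_lt hr.hasDerivAt xe hε hB h0l h0r h1 h01 hK₂ hB2 hf₀ hC₁
      (fun ℓ => (hKV ℓ).1) (fun ℓ => (hKV ℓ).2) hm2 hmC hmε (m ^ 4) rfl
      (linePotential 1 2 (m ^ 4) r) rfl
  have hψsol : IsRWSolution 1 2 (m ^ 4) r ψ := ⟨hψ2, fun z => hsol z.1 z.2⟩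
  -- K1 for this solution at `ρ = ρ₀`
  have hCI : ENNReal.ofReal c * kernelDeficit (linePotential 1 2 (m ^ 4) r) 0 ρ₀ ψ ≤
      channelEnergy (linePotential 1 2 (m ^ 4) r) 0 ρ₀ ψ atTop +
        channelEnergy (linePotential 1 2 (m ^ 4) r) 0 ρ₀ ψ atBot :=
    H r 0 hr 2 (m ^ 4) le_rfl hℓ2 ρ₀ le_rfl ψ hψsol
  -- upper bounds on the channel energies: LANDED monotonicity + the packet bound at `±T`
  have hmono := RW.exteriorEnergy_antitoneOn_rw hr hℓ2 hψsol 0 hρ₀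
  obtain ⟨hup, hdown⟩ := channelEnergy_le_of_antitone hmono hT0.le
  have hedgeT : 0 - ρ₀ - |T| ≤ α := by rw [abs_of_pos hT0]; exact hedge
  have hedgeT' : 0 - ρ₀ - |(-T)| ≤ α := by rw [abs_neg, abs_of_pos hT0]; exact hedge
  have hup' := hup.trans (exteriorEnergy_le_of_near hρ₀ hedgeT hψ2 hsupp (he0 T) (hInt T) hplus)
  have hdown' := hdown.trans
    (exteriorEnergy_le_of_near hρ₀ hedgeT' hψ2 hsupp (he0 (-T)) (hInt (-T)) hminus)
  -- lower bound on the deficit: LANDED near-side kernel census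
  have hlow : ENNReal.ofReal (∫ x, g x ^ 2) ≤ kernelDeficit (linePotential 1 2 (m ^ 4) r) 0 ρ₀ ψ :=
    deficit_lower_bound hr (m ^ 4) hℓ2 ρ₀ ψ hψ2 hψ0 g hg2.continuous hψ1
      (fun x hx => hg0r x (by rw [hxe_def]; linarith)) hgint
      (fun p hp hfin => KruskalRestFrameVirial.stub_nearKernelCensus hr 2 (m ^ 4) hℓ2 ρ₀ p hp hfin)
  -- contradiction
  set E₀ : ℝ := ∫ x, g x ^ 2 with hE₀_def
  have key : ENNReal.ofReal (c * E₀) ≤ ENNReal.ofReal (c / 4 * E₀ + c / 4 * E₀) := by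
    calc ENNReal.ofReal (c * E₀) = ENNReal.ofReal c * ENNReal.ofReal E₀ := ENNReal.ofReal_mul hc.le
      _ ≤ ENNReal.ofReal c * kernelDeficit (linePotential 1 2 (m ^ 4) r) 0 ρ₀ ψ := by gcongr
      _ ≤ _ := hCI
      _ ≤ ENNReal.ofReal (c / 4 * E₀) + ENNReal.ofReal (c / 4 * E₀) := add_le_add hup' hdown'
      _ = ENNReal.ofReal (c / 4 * E₀ + c / 4 * E₀) :=
          (ENNReal.ofReal_add (by positivity) (by positivity)).symm
  have key' := (ENNReal.ofReal_le_ofReal_iff (by positivity)).1 key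
  nlinarith [mul_pos hc hgpos]

end Summit.FinalStateConjecture.FinalStateConjecture.Theorems

end
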